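import Mathlib
import Summits.ValiantsHypothesis.ValiantsHypothesis.Theorems.NewtonUnitEquationsTwoProductsFormalLogLinearisationDefs
import Summits.ValiantsHypothesis.ValiantsHypothesis.Theorems.NewtonUnitEquationsTwoProductsFormalLogLinearisationTame
import HarnessLib

/-!
# Crux `TwoProducts` (stmt-ValiantsHypothesis-5906), line `formal-log-linearisation`: the log-sum engine at `m = 1`
# (CALIBRATION INSTANCE — the engine itself is the line's OPEN core and is NOT claimed)

The registered line `Cruxes/TwoProducts/Lines/formal-log-linearisation.lean` reduces the crux to its STUB 5, the
log-sum engine `LogSumEngine`: for `t ≥ 2`, any finite set of weight-visible points of the support of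
`D = Σ_{j<m} log(1+u_j) − Σ_{j<m} log(1+v_j)` (tails `u_j, v_j` with `≤ t` monomials, zero constant term) has at most
`2^(a·m)·(t+2)^b` elements.  This file proves the engine's statement with `m = 1` FIXED, with the sharp count, over
the objects of `Theorems/NewtonUnitEquationsTwoProductsFormalLogLinearisationDefs.lean` (= the line's objects):

* `logVisible_subset_support_sub` — THE CALIBRATION DATUM: for `m = 1` every visible point of `supp D` is a monomial
  of the DIFFERENCE `u − v` of the two tails (indeed, for every valid weight `ξ`, the strict `ξ`-top of `supp D` is
  the strict `ξ`-top of `supp (u − v)`): writing `u = v + δ`, the layer `u^r − v^r = Σ_{i<r} C(r,i) v^i δ^{r−i}` of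
  `D` (`r ≥ 2`) lives strictly below the top weight of `δ`, because valid weights are negative on all tails;
* `logSumEngine_one` — hence `#S ≤ #supp(u − v) ≤ 2t` for every finite `S ⊆ logVisible u v`;
* `logSumEngine_m_one` — literally `LogSumEngine`'s body with `m = 1` (and `a = b = 1`).

So at `m = 1` the log-sum sees nothing beyond the difference of the two tails; the engine's content starts at
`m = 2`, where the top of `supp D` can come from mixed layers of different factors (for where that content starts,
in the lifted-pencil currency, see val-width-0318-p2's memo, evidence n°45 on item stmt-ValiantsHypothesis-5906).

Honest framing: calibration instance for a registered NON-record line of an OPEN crux; the engine (all `m`,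
`t ≥ 2`), the line and the crux `TwoProducts` are untouched and OPEN; nothing here bears on `VP ≠ VNP` (NOT
proved).  No definitions, no named facts.
-/

set_option linter.dupNamespace false

noncomputable section

open scoped BigOperators
open MvPolynomial

namespace Summit.ValiantsHypothesis.ValiantsHypothesis.Theorems.NewtonUnitEquations.TwoProducts.FormalLogLinearisation

/-! ### Weights of supports of products and powers -/

-- `wt_add`, `wt_zero`: the landed `…FormalLogLinearisationTame.lean` (p583827), imported.

/-- Weights on the support of a power: if every monomial of `p` has weight `≤ M` then every monomial of `p ^ k`
has weight `≤ k · M`. [folklore] -/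
theorem wt_le_of_mem_support_pow (ξ : Fin 2 → ℝ) (p : MvPolynomial (Fin 2) ℂ) (M : ℝ)
    (hM : ∀ a ∈ p.support, wt ξ a ≤ M) :
    ∀ (k : ℕ), ∀ b ∈ (p ^ k).support, wt ξ b ≤ (k : ℝ) * M := by
  classical
  intro k
  induction k with
  | zero =>
    intro b hb
    rw [pow_zero] at hb
    have : b = 0 := by
      have h1 : (1 : MvPolynomial (Fin 2) ℂ) = monomial 0 1 := rfl
      rw [h1, support_monomial, if_neg one_ne_zero, Finset.mem_singleton] at hb
      exact hb
    subst this
    simp [wt_zero]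
  | succ k ih =>
    intro b hb
    rw [pow_succ] at hb
    obtain ⟨a, ha, c, hc, rfl⟩ := Finset.mem_add.1 (support_mul _ _ hb)
    rw [wt_add, Nat.cast_succ, add_mul, one_mul]
    exact add_le_add (ih a ha) (hM c hc)

/-- Weights on the support of a power of a polynomial with NEGATIVE weights are negative from the first power
on. [folklore] -/
theorem wt_neg_of_mem_support_pow (ξ : Fin 2 → ℝ) (p : MvPolynomial (Fin 2) ℂ)
    (hneg : ∀ a ∈ p.support, wt ξ a < 0) :
    ∀ (k : ℕ), 1 ≤ k → ∀ b ∈ (p ^ k).support, wt ξ b < 0 := by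
  classical
  intro k hk b hb
  obtain ⟨k', rfl⟩ : ∃ k', k = k' + 1 := ⟨k - 1, by omega⟩
  rw [pow_succ] at hb
  obtain ⟨a, ha, c, hc, rfl⟩ := Finset.mem_add.1 (support_mul _ _ hb)
  rw [wt_add]
  have h1 : wt ξ a ≤ (k' : ℝ) * 0 := wt_le_of_mem_support_pow ξ p 0 (fun a ha => (hneg a ha).le) k' a ha
  rw [mul_zero] at h1
  linarith [hneg c hc]

/-! ### The layers `u^r − v^r`, `r ≥ 2`, lie strictly below the top of `u − v` -/

/-- **The mixed layers are low.** Let `ξ` be negative on `supp u ∪ supp v` and let `n₀` be a `ξ`-top monomial of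
`δ = u − v`.  Then for `r ≥ 2` every monomial of `u^r − v^r = Σ_{i<r} C(r,i) v^i δ^{r-i}` has weight `< wt ξ n₀`.
[folklore] -/
theorem wt_lt_of_mem_support_pow_sub_pow (ξ : Fin 2 → ℝ) (u v : MvPolynomial (Fin 2) ℂ)
    (hu : ∀ a ∈ u.support, wt ξ a < 0) (hv : ∀ a ∈ v.support, wt ξ a < 0)
    (n₀ : Expo) (hn₀ : n₀ ∈ (u - v).support) (htop : ∀ a ∈ (u - v).support, wt ξ a ≤ wt ξ n₀)
    (r : ℕ) (hr : 2 ≤ r) : ∀ x ∈ (u ^ r - v ^ r).support, wt ξ x < wt ξ n₀ := by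
  classical
  set δ := u - v with hδ
  have hw₀ : wt ξ n₀ < 0 := by
    have := support_sub (σ := Fin 2) u v hn₀
    rcases Finset.mem_union.1 this with h | h
    · exact hu _ h
    · exact hv _ h
  -- binomial expansion of `u^r = (v + δ)^r` with the term `i = r` split off
  have hexp : u ^ r - v ^ r =
      ∑ i ∈ Finset.range r, v ^ i * δ ^ (r - i) * ((r.choose i : ℕ) : MvPolynomial (Fin 2) ℂ) := by
    have huv : u = v + δ := by rw [hδ]; ring
    rw [huv, add_pow, Finset.sum_range_succ, Nat.sub_self, pow_zero, mul_one, Nat.choose_self,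
      Nat.cast_one, mul_one, add_sub_cancel_right]
  intro x hx
  rw [hexp] at hx
  obtain ⟨i, hi, hxi⟩ : ∃ i ∈ Finset.range r,
      x ∈ (v ^ i * δ ^ (r - i) * ((r.choose i : ℕ) : MvPolynomial (Fin 2) ℂ)).support := by
    by_contra hcon
    push Not at hcon
    rw [mem_support_iff, coeff_sum] at hx
    exact hx (Finset.sum_eq_zero fun i hi => notMem_support_iff.1 (hcon i hi))
  have hir : i < r := Finset.mem_range.1 hi
  -- `x ∈ supp (v^i δ^{r-i})`
  have hx' : x ∈ (v ^ i * δ ^ (r - i)).support := by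
    have hC : v ^ i * δ ^ (r - i) * ((r.choose i : ℕ) : MvPolynomial (Fin 2) ℂ) =
        ((r.choose i : ℕ) : ℂ) • (v ^ i * δ ^ (r - i)) := by
      rw [smul_eq_C_mul, map_natCast, mul_comm]
    rw [hC] at hxi
    exact support_smul hxi
  obtain ⟨a, ha, b, hb, rfl⟩ := Finset.mem_add.1 (support_mul _ _ hx')
  rw [wt_add]
  have hb' : wt ξ b ≤ ((r - i : ℕ) : ℝ) * wt ξ n₀ := wt_le_of_mem_support_pow ξ δ _ htop _ b hb
  rcases Nat.eq_zero_or_pos i with rfl | hipos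
  · -- `i = 0`: `a = 0` and `b ∈ supp δ^r`, `r ≥ 2`
    have ha0 : wt ξ a ≤ 0 := by
      have := wt_le_of_mem_support_pow ξ v 0 (fun a ha => (hv a ha).le) 0 a ha
      simpa using this
    have hr2 : (2 : ℝ) ≤ ((r - 0 : ℕ) : ℝ) := by exact_mod_cast (by omega : 2 ≤ r - 0)
    nlinarith
  · -- `i ≥ 1`: `wt a < 0` and `wt b ≤ wt n₀`
    have ha' : wt ξ a < 0 := wt_neg_of_mem_support_pow ξ v hv i hipos a ha
    have hk1 : (1 : ℝ) ≤ ((r - i : ℕ) : ℝ) := by exact_mod_cast (by omega : 1 ≤ r - i)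
    nlinarith

/-! ### `m = 1`: the log-sum's top is the top of the difference of the tails -/

/-- For `m = 1` the log-sum coefficient is `Σ_{r=1}^{|n|} (−1)^{r+1}/r · [X^n](u^r − v^r)`. [folklore] -/
theorem logDiff_one_eq (u v : Fin 1 → MvPolynomial (Fin 2) ℂ) (n : Expo) :
    logDiff u v n = ∑ r ∈ Finset.Icc 1 (n 0 + n 1),
      (-1 : ℂ) ^ (r + 1) / (r : ℂ) * coeff n (u 0 ^ r - v 0 ^ r) := by
  unfold logDiff logCoeff
  rw [Fin.sum_univ_one, Fin.sum_univ_one, ← Finset.sum_sub_distrib]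
  refine Finset.sum_congr rfl fun r _ => ?_
  rw [coeff_sub, mul_sub]

/-- **At and above the top weight of `u − v`, the log-sum coefficient IS the coefficient of `u − v`** (`m = 1`,
`ξ` valid, `n₀` a `ξ`-top monomial of `u − v`). [folklore] -/
theorem logDiff_one_eq_coeff_sub (u v : Fin 1 → MvPolynomial (Fin 2) ℂ)
    (hu0 : coeff 0 (u 0) = 0) (hv0 : coeff 0 (v 0) = 0) (ξ : Fin 2 → ℝ) (hξ : ValidWeight u v ξ)
    (n₀ : Expo) (hn₀ : n₀ ∈ (u 0 - v 0).support) (htop : ∀ a ∈ (u 0 - v 0).support, wt ξ a ≤ wt ξ n₀)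
    (n : Expo) (hn : wt ξ n₀ ≤ wt ξ n) : logDiff u v n = coeff n (u 0 - v 0) := by
  rw [logDiff_one_eq]
  have hlow : ∀ r ∈ Finset.Icc 1 (n 0 + n 1), r ≠ 1 →
      (-1 : ℂ) ^ (r + 1) / (r : ℂ) * coeff n (u 0 ^ r - v 0 ^ r) = 0 := by
    intro r hr hr1
    have hr2 : 2 ≤ r := by have := (Finset.mem_Icc.1 hr).1; omega
    have hzero : coeff n (u 0 ^ r - v 0 ^ r) = 0 := by
      by_contra hne
      have hlt := wt_lt_of_mem_support_pow_sub_pow ξ (u 0) (v 0) (hξ.1 0) (hξ.2 0) n₀ hn₀ htop r hr2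
        n (mem_support_iff.2 hne)
      linarith
    rw [hzero, mul_zero]
  by_cases hN : 1 ≤ n 0 + n 1
  · rw [Finset.sum_eq_single_of_mem 1 (Finset.mem_Icc.2 ⟨le_refl 1, hN⟩) fun r hr hr1 => hlow r hr hr1]
    norm_num
  · -- `n = 0`: the sum is empty and `[X^0](u − v) = 0`
    have hn0 : n = 0 := by
      ext i
      fin_cases i <;> simp <;> omega
    rw [Finset.Icc_eq_empty (by omega), Finset.sum_empty, hn0, coeff_sub, hu0, hv0, sub_zero]

/-- **The calibration datum (`m = 1`).** Every visible point of `supp D`, `D = log(1+u) − log(1+v)`, is a monomial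
of `u − v`; more precisely, if `l` is the strict `ξ`-top of `supp D` for a valid weight `ξ`, then `l ∈ supp (u − v)`
and `l` is the strict `ξ`-top of `supp (u − v)`. [folklore] -/
theorem logVisible_subset_support_sub (u v : Fin 1 → MvPolynomial (Fin 2) ℂ)
    (hu0 : coeff 0 (u 0) = 0) (hv0 : coeff 0 (v 0) = 0) :
    logVisible u v ⊆ ↑(u 0 - v 0).support := by
  classical
  intro l hl
  obtain ⟨ξ, hξ, hlS, hltop⟩ := hl
  -- `δ = u − v ≠ 0`: otherwise `supp D = ∅`
  have hlD : logDiff u v l ≠ 0 := hlS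
  by_cases hδ : u 0 - v 0 = 0
  · exfalso
    apply hlD
    rw [logDiff_one_eq]
    refine Finset.sum_eq_zero fun r _ => ?_
    have : u 0 = v 0 := sub_eq_zero.1 hδ
    rw [this, sub_self, coeff_zero, mul_zero]
  -- a `ξ`-top monomial `n₀` of `δ`
  obtain ⟨n₀, hn₀, htop⟩ := Finset.exists_max_image (u 0 - v 0).support (wt ξ) (support_nonempty.2 hδ)
  -- `n₀ ∈ supp D`, so `wt n₀ ≤ wt l`
  have hn₀D : n₀ ∈ logSupport u v := by
    show logDiff u v n₀ ≠ 0
    rw [logDiff_one_eq_coeff_sub u v hu0 hv0 ξ hξ n₀ hn₀ htop n₀ le_rfl]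
    exact mem_support_iff.1 hn₀
  have hle : wt ξ n₀ ≤ wt ξ l := by
    by_cases h : n₀ = l
    · rw [h]
    · exact (hltop n₀ hn₀D h).le
  -- hence `[X^l] D = [X^l] δ ≠ 0`
  have := logDiff_one_eq_coeff_sub u v hu0 hv0 ξ hξ n₀ hn₀ htop l hle
  rw [this] at hlD
  exact Finset.mem_coe.2 (mem_support_iff.2 hlD)

/-- **The log-sum engine at `m = 1`, sharp count:** for tails `u, v` (zero constant term, at most `t` monomials
each) every finite set of visible points of `supp (log(1+u) − log(1+v))` has at most `#supp(u − v) ≤ 2t` elements.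
(Calibration instance; the engine for all `m` is the line's OPEN core, NOT claimed.) [folklore] -/
theorem logSumEngine_one (t : ℕ) (u v : Fin 1 → MvPolynomial (Fin 2) ℂ)
    (hu : ∀ j, coeff 0 (u j) = 0 ∧ (u j).support.card ≤ t) (hv : ∀ j, coeff 0 (v j) = 0 ∧ (v j).support.card ≤ t)
    (S : Finset Expo) (hS : ↑S ⊆ logVisible u v) : S.card ≤ 2 * t := by
  classical
  have hsub : S ⊆ (u 0 - v 0).support := by
    intro l hl
    exact Finset.mem_coe.1 (logVisible_subset_support_sub u v (hu 0).1 (hv 0).1 (hS (Finset.mem_coe.2 hl)))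
  calc S.card ≤ (u 0 - v 0).support.card := Finset.card_le_card hsub
    _ ≤ ((u 0).support ∪ (v 0).support).card := Finset.card_le_card (support_sub _ _ _)
    _ ≤ (u 0).support.card + (v 0).support.card := Finset.card_union_le _ _
    _ ≤ t + t := add_le_add (hu 0).2 (hv 0).2
    _ = 2 * t := by ring

/-- **`LogSumEngine` with `m = 1` fixed** (the body of the line's `LogSumEngine` at `m = 1`, constants
`a = b = 1`: `#S ≤ 2^(1·1)·(t+2)^1`).  Calibration instance only; the engine (all `m`, `t ≥ 2`) is OPEN and NOT
claimed. [folklore] -/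
theorem logSumEngine_m_one :
    ∀ (t : ℕ), 2 ≤ t → ∀ (u v : Fin 1 → MvPolynomial (Fin 2) ℂ),
      (∀ j, coeff 0 (u j) = 0 ∧ (u j).support.card ≤ t) → (∀ j, coeff 0 (v j) = 0 ∧ (v j).support.card ≤ t) →
        ∀ S : Finset Expo, (↑S ⊆ logVisible u v) → S.card ≤ 2 ^ (1 * 1) * (t + 2) ^ 1 := by
  intro t _ u v hu hv S hS
  have h := logSumEngine_one t u v hu hv S hS
  calc S.card ≤ 2 * t := h
    _ ≤ 2 ^ (1 * 1) * (t + 2) ^ 1 := by ring_nf; omega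

end Summit.ValiantsHypothesis.ValiantsHypothesis.Theorems.NewtonUnitEquations.TwoProducts.FormalLogLinearisation

end
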